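import Mathlib.Analysis.Calculus.Deriv.Comp
import Literature.Analysis.ODE.OneSidedComparison
import Literature.Analysis.FluidPDE.FluidComputer.ReachCircuit
import HarnessLib

/-!
# Fluid computer blueprint — reach certificates: the interface, its Grönwall and BARRIER inhabitants, re-certification

HONEST FRAMING: low prior, high value-of-information experiment on Tao's machine paradigm; NOT a
claim that NS blows up. Everything in this file is finite-dimensional ODE / differential-inclusion
theory about a circuit DESIGN; nothing is asserted about the Navier–Stokes equations.

`ReachCircuit.lean` types Tao's machine (J. Amer. Math. Soc. 29 (2016), §1.3) as a circuit design
whose CIRCUIT group is a certified ROBUST REACH–AVOID TUBE: a closed time-dependent family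
`Tube p σ ⊆ U` and one certificate `cert` — every continuous curve `x : [0, σT] → O`, `σT ≤ τc`,
from `p ∈ Ain`, staying in the open working region `U` on `[0, σT)` with right derivative `ε`-close
to the design vector field `F` there, ends in `Tube p σT`, and if `σT = τc` it has visited `Aout`.
This file isolates that group as a free-standing finite-dimensional object and gives it two
inhabitant schemas with OPPOSITE defect budgets:

* `ReachCertificate F U ε τc Ain Aout` — exactly the five CIRCUIT fields of `ReachCircuit`
  (`Tube`, `Tube_closed`, `Tube_zero`, `Tube_sub`, `cert`), parametrised by the data they share
  with the dynamics fields. This is the interface a gadget designer (validated numerics, barrier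
  functions, interval reachability) has to meet; the blueprint's dynamics layer consumes it.
* `ReachCertificate.ofFlow` — the GRÖNWALL inhabitant (the CIRCUIT group of `LocalCircuit`): an
  `L`-Lipschitz `F` on `U`, its flow `Φ` from `Ain` over `[0, τc]`, a tube radius `δsh` with
  `closedBall (Φ σ p) δsh ⊆ U`, a delayed abrupt transition with margin (`dat`), and the budget
  `gronwallBound 0 L ε τc ≤ δsh`, i.e. `ε ≤ δsh · L/(e^{Lτc} - 1)`: EXPONENTIALLY small in the
  rate–delay product `L τc`.
* `BarrierGate F U ε τc Ain Aout` and `BarrierGate.toReachCertificate` — the BARRIER inhabitant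
  (Prajna–Jadbabaie-type barrier certificate + a progress function, for the differential inclusion
  `x' ∈ F(x) + B̄(0, ε)`): a continuous `V`, differentiable on `U`, with `Ain ⊆ {V ≤ 0} ⊆ U` and the
  ROBUST BARRIER CONDITION `V'(q)·F(q) + ‖V'(q)‖ ε < 0` on the zero level (AVOID: `{V ≤ 0}` is
  forward invariant for every `ε`-approximate trajectory — a fencing argument,
  `image_le_of_deriv_right_lt_deriv_boundary'`); and a progress function `P`, differentiable on `U`,
  with ROBUST RATE `c + ‖P'(q)‖ ε ≤ P'(q)·F(q)` on `{V ≤ 0} ∖ Aout`, `Pmin ≤ P` on `Ain`,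
  `P ≤ Pmax` on `{V ≤ 0}`, and the TIME BUDGET `Pmax - Pmin < c τc` (REACH: a curve avoiding
  `Aout` for the whole cycle would gain more progress than is available — one-sided mean value
  inequality). Its defect budget is LINEAR in the margins (`barrier_of_margins`,
  `progress_of_margins`): `ε < mB/MB` and `ε < (mP τc - (Pmax - Pmin))/(MP τc)`; no `e^{-Lτc}`.
* `relaxationGate` — CALIBRATION: the interface is inhabited with order-one data and defect `1/4`
  by a one-mode relaxation design (not a delayed abrupt transition; it calibrates the typing only).
* `ReachCircuit.certificate`, `ReachCircuit.withCertificate`, `ReachCircuit.ofBarrier` —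
  RE-CERTIFICATION: the CIRCUIT group of a reach design is a `ReachCertificate` and may be replaced
  by any other for the same `(F, U, ε, τc, Ain, Aout)`; the pump cascade it induces — hence every
  blow-up conclusion downstream — is LITERALLY unchanged (`withCertificate_toPumpCascade` is `rfl`);
  only the tube-dependent `H10Control` hypothesis of liveness changes, and for a barrier gate it
  becomes `H¹⁰`-boundedness on `{read ∈ {V ≤ 0}, junk ≤ jrun √E_n}` (`live_of_barrier`).

## Honest ceiling

Which schema a concrete gate admits, and with what margin, is a property of the DESIGN. For Tao's
own five-mode gate (`Tao2016AveragedNS/DelayCircuit.lean`) no certificate of any kind tolerates a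
defect above the seed transfer rate: `Tao2016AveragedNS/GateFragility.lean`
(`not_firesOnBudget_of_seed_mul_le`) defeats every firing notion at forcing budget
`≥ ε² e^{-K¹⁰} · T`. There the exponential is the price of ARMING an exponential instability with a
tiny seed, not of Grönwall bookkeeping; a barrier/progress certificate for that gate exists only
with `ε` below the seed rate (`BarrierGate.ε_lt_norm_F` is the trivial necessary condition of this
kind: the tolerated defect is below the slowest design speed off the output region). A gate with a
polynomial margin must produce its delay by path length at speed bounded below, not by slowness —
a finite-dimensional design question this file poses and does not answer. [cite: Tao2016AveragedNS, §1.3 pp. 10–11]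
-/

noncomputable section

open Set Filter Topology
open scoped NNReal

namespace Literature.Analysis.FluidPDE.FluidComputer

variable {O : Type*} [NormedAddCommGroup O] [NormedSpace ℝ O]

/-! ### §0. Robust evaluation of a real linear functional -/

/-- `φ w ≤ φ v + ‖φ‖ ‖w - v‖` for a continuous real linear functional. [folklore] -/
theorem clm_apply_le_add (φ : O →L[ℝ] ℝ) (v w : O) : φ w ≤ φ v + ‖φ‖ * ‖w - v‖ := by
  have h1 : φ w - φ v = φ (w - v) := (map_sub φ w v).symm
  have h2 : φ (w - v) ≤ ‖φ‖ * ‖w - v‖ :=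
    (le_abs_self _).trans (by simpa only [Real.norm_eq_abs] using φ.le_opNorm (w - v))
  linarith

/-- `φ v - ‖φ‖ ‖w - v‖ ≤ φ w` for a continuous real linear functional. [folklore] -/
theorem clm_sub_le_apply (φ : O →L[ℝ] ℝ) (v w : O) : φ v - ‖φ‖ * ‖w - v‖ ≤ φ w := by
  have h1 : φ v - φ w = φ (v - w) := (map_sub φ v w).symm
  have h2 : φ (v - w) ≤ ‖φ‖ * ‖v - w‖ :=
    (le_abs_self _).trans (by simpa only [Real.norm_eq_abs] using φ.le_opNorm (v - w))
  rw [norm_sub_rev] at h2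
  linarith

/-! ### §1. The interface: a robust reach–avoid certificate for `x' ∈ F(x) + B̄(0, ε)` on `U` -/

/-- **A robust reach–avoid certificate** for the design vector field `F` on the open working region
`U`, defect level `ε`, cycle time `τc`, input region `Ain` and output region `Aout`: a reach tube
`Tube p σ` (`p ∈ Ain`, `σ ∈ [0, τc]`) with closed graph, starting at `p`, inside `U`, and the
certificate that every continuous curve on `[0, σT]`, `σT ≤ τc`, from `p ∈ Ain`, in `U` on
`[0, σT)` with right derivative `ε`-close to `F` there, ends in `Tube p σT` and, if `σT = τc`, has
visited `Aout`. These are exactly the CIRCUIT fields of `ReachCircuit`. [folklore] -/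
structure ReachCertificate (F : O → O) (U : Set O) (ε τc : ℝ) (Ain Aout : Set O) where
  /-- the readouts certified reachable at rescaled time `σ` from `p` -/
  Tube : O → ℝ → Set O
  /-- closed graph over `[0, τc]` -/
  Tube_closed : ∀ p ∈ Ain, IsClosed {z : ℝ × O | z.1 ∈ Icc 0 τc ∧ z.2 ∈ Tube p z.1}
  /-- it starts at the input readout -/
  Tube_zero : ∀ p ∈ Ain, p ∈ Tube p 0
  /-- AVOID: inside the working region for the whole cycle -/
  Tube_sub : ∀ p ∈ Ain, ∀ σ ∈ Icc 0 τc, Tube p σ ⊆ U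
  /-- the certificate proper (tube membership, and REACH at `σT = τc`) -/
  cert : ∀ p ∈ Ain, ∀ (σT : ℝ) (x : ℝ → O), 0 ≤ σT → σT ≤ τc → x 0 = p →
    ContinuousOn x (Icc 0 σT) → (∀ σ ∈ Ico 0 σT, x σ ∈ U) →
      (∀ σ ∈ Ico 0 σT, ∃ W : O, HasDerivWithinAt x W (Ici σ) σ ∧ ‖W - F (x σ)‖ ≤ ε) →
        x σT ∈ Tube p σT ∧ (σT = τc → ∃ σ ∈ Icc 0 τc, x σ ∈ Aout)

/-! ### §2. The Grönwall inhabitant (the CIRCUIT group of a local design) -/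

/-- **Grönwall's inequality for approximate trajectories, from a flow.** If `F` is `L`-Lipschitz on
`U`, `Φ` is its flow from `p` over `[0, τc]` and the closed `δsh`-balls about the orbit lie in `U`,
then every continuous curve on `[0, σT]`, `σT ≤ τc`, with `x 0 = p`, in `U` on `[0, σT)` and with
right derivative `ε`-close to `F` there, is within `gronwallBound 0 L ε σ` of `Φ σ p` for all
`σ ≤ σT` (`dist_le_of_approx_trajectories_ODE_of_mem`). [folklore] -/
theorem dist_flow_le_gronwallBound {F : O → O} {U : Set O} {ε τc : ℝ} {L : ℝ≥0}
    (hF : LipschitzOnWith L F U) {Φ : ℝ → O → O} {p : O} (flow_zero : Φ 0 p = p)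
    (flow_cont : ContinuousOn (fun σ => Φ σ p) (Icc 0 τc))
    (flow_deriv : ∀ σ ∈ Ico 0 τc, HasDerivWithinAt (fun σ' => Φ σ' p) (F (Φ σ p)) (Ici σ) σ)
    (flow_mem : ∀ σ ∈ Ico 0 τc, Φ σ p ∈ U)
    {σT : ℝ} (hσT : σT ≤ τc) {x : ℝ → O} (hx0 : x 0 = p) (hcont : ContinuousOn x (Icc 0 σT))
    (hU : ∀ σ ∈ Ico 0 σT, x σ ∈ U)
    (hW : ∀ σ ∈ Ico 0 σT, ∃ W : O, HasDerivWithinAt x W (Ici σ) σ ∧ ‖W - F (x σ)‖ ≤ ε) :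
    ∀ σ ∈ Icc 0 σT, dist (x σ) (Φ σ p) ≤ gronwallBound 0 (L : ℝ) ε σ := by
  choose! W hW using hW
  have key := dist_le_of_approx_trajectories_ODE_of_mem
    (v := fun _ => F) (s := fun _ => U) (K := L)
    (f := x) (f' := W) (g := fun σ => Φ σ p) (g' := fun σ => F (Φ σ p))
    (a := 0) (b := σT) (εf := ε) (εg := 0) (δ := 0)
    (fun _ _ => hF) hcont (fun σ hσ => (hW σ hσ).1)
    (fun σ hσ => by rw [dist_eq_norm]; exact (hW σ hσ).2)
    hU
    (flow_cont.mono (Icc_subset_Icc_right hσT))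
    (fun σ hσ => flow_deriv σ ⟨hσ.1, hσ.2.trans_le hσT⟩)
    (fun σ _ => (dist_self _).le)
    (fun σ hσ => flow_mem σ ⟨hσ.1, hσ.2.trans_le hσT⟩)
    (by simp only [hx0, flow_zero, dist_self, le_refl])
  intro σ hσ
  simpa only [add_zero, sub_zero] using key σ hσ

/-- **The Grönwall reach certificate of a flow** (the CIRCUIT group of `LocalCircuit`): `F`
`L`-Lipschitz on `U`, its flow `Φ` from `Ain` over `[0, τc]`, a tube radius `δsh` whose closed balls
about the orbits lie in `U` (`tube`), a delayed abrupt transition with margin (`dat`), and the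
DEFECT BUDGET `gronwallBound 0 L ε τc ≤ δsh` (`ε ≤ δsh · L/(e^{Lτc} - 1)`, exponentially small in
`L τc`). The tube is the closed `gronwallBound 0 L ε σ`-ball about `Φ σ p`. [folklore] -/
def ReachCertificate.ofFlow {F : O → O} {U : Set O} {ε τc : ℝ} {Ain Aout : Set O}
    (hε : 0 ≤ ε) (L : ℝ≥0) (hF : LipschitzOnWith L F U) (Φ : ℝ → O → O)
    (flow_zero : ∀ p ∈ Ain, Φ 0 p = p)
    (flow_cont : ∀ p ∈ Ain, ContinuousOn (fun σ => Φ σ p) (Icc 0 τc))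
    (flow_deriv : ∀ p ∈ Ain, ∀ σ ∈ Ico 0 τc,
      HasDerivWithinAt (fun σ' => Φ σ' p) (F (Φ σ p)) (Ici σ) σ)
    (δsh : ℝ) (budget : gronwallBound 0 (L : ℝ) ε τc ≤ δsh)
    (tube : ∀ p ∈ Ain, ∀ σ ∈ Icc 0 τc, Metric.closedBall (Φ σ p) δsh ⊆ U)
    (dat : ∀ p ∈ Ain, ∃ σ : ℝ, 0 ≤ σ ∧ σ ≤ τc ∧ Metric.closedBall (Φ σ p) δsh ⊆ Aout) :
    ReachCertificate F U ε τc Ain Aout := by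
  -- the Grönwall bound is monotone in time, hence `≤ δsh` within the cycle, hence `δsh ≥ 0`
  have hmono : Monotone (gronwallBound 0 (L : ℝ) ε) := gronwallBound_mono le_rfl hε L.coe_nonneg
  have hle : ∀ {σ : ℝ}, σ ≤ τc → gronwallBound 0 (L : ℝ) ε σ ≤ δsh := fun hσ => (hmono hσ).trans budget
  have hcontg : Continuous (gronwallBound 0 (L : ℝ) ε) :=
    continuous_iff_continuousAt.2 fun y => (hasDerivAt_gronwallBound 0 (L : ℝ) ε y).continuousAt
  exact
  { Tube := fun p σ => Metric.closedBall (Φ σ p) (gronwallBound 0 (L : ℝ) ε σ)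
    Tube_closed := by
      intro p hp
      have hf : ContinuousOn
          (fun z : ℝ × O => (dist z.2 (Φ z.1 p), gronwallBound 0 (L : ℝ) ε z.1))
          (Icc 0 τc ×ˢ univ) := by
        refine ContinuousOn.prodMk ?_ (hcontg.comp continuous_fst).continuousOn
        exact continuous_dist.comp_continuousOn (continuous_snd.continuousOn.prodMk
          ((flow_cont p hp).comp continuous_fst.continuousOn fun z hz => (mem_prod.1 hz).1))
      have h := hf.preimage_isClosed_of_isClosed (isClosed_Icc.prod isClosed_univ) isClosed_le_prod
      have hEq : {z : ℝ × O | z.1 ∈ Icc 0 τc ∧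
          z.2 ∈ Metric.closedBall (Φ z.1 p) (gronwallBound 0 (L : ℝ) ε z.1)} =
          Icc 0 τc ×ˢ univ ∩ (fun z : ℝ × O =>
            (dist z.2 (Φ z.1 p), gronwallBound 0 (L : ℝ) ε z.1)) ⁻¹' {q : ℝ × ℝ | q.1 ≤ q.2} := by
        ext z
        simp only [mem_setOf_eq, mem_inter_iff, mem_prod, mem_univ, and_true, mem_preimage,
          Metric.mem_closedBall]
      show IsClosed {z : ℝ × O | z.1 ∈ Icc 0 τc ∧
        z.2 ∈ Metric.closedBall (Φ z.1 p) (gronwallBound 0 (L : ℝ) ε z.1)}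
      rw [hEq]
      exact h
    Tube_zero := fun p hp => by
      show p ∈ Metric.closedBall (Φ 0 p) (gronwallBound 0 (L : ℝ) ε 0)
      rw [Metric.mem_closedBall, flow_zero p hp, gronwallBound_x0, dist_self]
    Tube_sub := fun p hp σ hσ =>
      (Metric.closedBall_subset_closedBall (hle hσ.2)).trans (tube p hp σ hσ)
    cert := by
      intro p hp σT x hσT0 hσT hx0 hcont hU hW
      have hδ : 0 ≤ δsh := by
        have h1 : gronwallBound 0 (L : ℝ) ε 0 ≤ gronwallBound 0 (L : ℝ) ε τc :=
          hmono (hσT0.trans hσT)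
        rw [gronwallBound_x0] at h1
        exact h1.trans budget
      have h := dist_flow_le_gronwallBound hF (flow_zero p hp) (flow_cont p hp) (flow_deriv p hp)
        (fun σ hσ => tube p hp σ (Ico_subset_Icc_self hσ) (Metric.mem_closedBall_self hδ))
        hσT hx0 hcont hU hW
      refine ⟨Metric.mem_closedBall.2 (h σT ⟨hσT0, le_rfl⟩), fun hστ => ?_⟩
      obtain ⟨σ, hσ0, hσ, hball⟩ := dat p hp
      exact ⟨σ, ⟨hσ0, hσ⟩, hball (Metric.mem_closedBall.2
        ((h σ ⟨hσ0, hσ.trans_eq hστ.symm⟩).trans (hle hσ)))⟩ }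

/-! ### §3. The barrier inhabitant: barrier function + progress function, linear margins -/

/-- **A barrier gate**: a robust reach–avoid certificate for `x' ∈ F(x) + B̄(0, ε)` on `U` by a
BARRIER function `V` (continuous; differentiable on `U`; `Ain ⊆ {V ≤ 0} ⊆ U`; robust barrier
condition `V'(q)·F(q) + ‖V'(q)‖ ε < 0` on the zero level) and a PROGRESS function `P`
(differentiable on `U`; robust rate `c + ‖P'(q)‖ ε ≤ P'(q)·F(q)` on `{V ≤ 0} ∖ Aout`; `Pmin ≤ P` on
`Ain`, `P ≤ Pmax` on `{V ≤ 0}`; time budget `Pmax - Pmin < c τc`). A finite-dimensional object; for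
a polynomial `F` and semialgebraic regions, `V` and `P` are what sum-of-squares programming
searches for. [folklore] -/
structure BarrierGate (F : O → O) (U : Set O) (ε τc : ℝ) (Ain Aout : Set O) where
  /-- the working region is open and the parameters are nonnegative -/
  U_open : IsOpen U
  ε_nonneg : 0 ≤ ε
  τc_nonneg : 0 ≤ τc
  /-- BARRIER function -/
  V : O → ℝ
  V_cont : Continuous V
  /-- its derivative on the working region -/
  V' : O → O →L[ℝ] ℝ
  V_deriv : ∀ q ∈ U, HasFDerivAt V (V' q) q
  /-- the safe set `{V ≤ 0}` lies in the working region … -/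
  safe_sub : ∀ q, V q ≤ 0 → q ∈ U
  /-- … and contains the input region -/
  Ain_safe : ∀ p ∈ Ain, V p ≤ 0
  /-- ROBUST BARRIER CONDITION on the zero level: `F` points strictly inward even after an
  `ε`-perturbation -/
  barrier : ∀ q ∈ U, V q = 0 → V' q (F q) + ‖V' q‖ * ε < 0
  /-- PROGRESS function -/
  P : O → ℝ
  P' : O → O →L[ℝ] ℝ
  P_deriv : ∀ q ∈ U, HasFDerivAt P (P' q) q
  /-- robust progress rate off the output region -/
  c : ℝ
  progress : ∀ q ∈ U, V q ≤ 0 → q ∉ Aout → c + ‖P' q‖ * ε ≤ P' q (F q)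
  /-- progress available: at least `Pmin` on inputs, at most `Pmax` on the safe set -/
  Pmin : ℝ
  Pmax : ℝ
  P_ge : ∀ p ∈ Ain, Pmin ≤ P p
  P_le : ∀ q, V q ≤ 0 → P q ≤ Pmax
  /-- TIME BUDGET: a curve avoiding `Aout` for the whole cycle would gain more progress than is
  available -/
  budget : Pmax - Pmin < c * τc

namespace BarrierGate

variable {F : O → O} {U : Set O} {ε τc : ℝ} {Ain Aout : Set O} (G : BarrierGate F U ε τc Ain Aout)

/-- The **safe set** `{V ≤ 0}` of the barrier. [folklore] -/
def Safe : Set O := {q | G.V q ≤ 0}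

/-- The safe set is closed (`V` is continuous). [folklore] -/
theorem isClosed_safe : IsClosed G.Safe := isClosed_le G.V_cont continuous_const

/-- The safe set lies in the working region. [folklore] -/
theorem safe_subset : G.Safe ⊆ U := fun q hq => G.safe_sub q hq

/-- The input region is safe. [folklore] -/
theorem Ain_subset_safe : Ain ⊆ G.Safe := fun p hp => G.Ain_safe p hp

/-- The progress function is continuous on the working region. [folklore] -/
theorem continuousOn_P : ContinuousOn G.P U :=
  fun q hq => (G.P_deriv q hq).continuousAt.continuousWithinAt

/-- **AVOID (robust forward invariance of the safe set).** Every continuous curve on `[0, σT]`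
starting in the safe set, lying in `U` on `[0, σT)` and having there a right derivative `ε`-close to
`F`, stays in the safe set: along the curve `V` has right derivative
`V'(x)·x' ≤ V'(x)·F(x) + ‖V'(x)‖ ε`, strictly negative wherever `V(x) = 0` (`barrier`), so `V ∘ x`
cannot cross `0` from below (`image_le_of_deriv_right_lt_deriv_boundary'`). [folklore] -/
theorem V_le_zero {σT : ℝ} {x : ℝ → O} (h0 : G.V (x 0) ≤ 0) (hcont : ContinuousOn x (Icc 0 σT))
    (hU : ∀ σ ∈ Ico 0 σT, x σ ∈ U)
    (hW : ∀ σ ∈ Ico 0 σT, ∃ W : O, HasDerivWithinAt x W (Ici σ) σ ∧ ‖W - F (x σ)‖ ≤ ε) :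
    ∀ σ ∈ Icc 0 σT, G.V (x σ) ≤ 0 := by
  choose! W hW using hW
  have hf : ContinuousOn (fun σ => G.V (x σ)) (Icc 0 σT) := G.V_cont.comp_continuousOn hcont
  have hf' : ∀ σ ∈ Ico 0 σT,
      HasDerivWithinAt (fun σ => G.V (x σ)) (G.V' (x σ) (W σ)) (Ici σ) σ :=
    fun σ hσ => (G.V_deriv (x σ) (hU σ hσ)).comp_hasDerivWithinAt σ (hW σ hσ).1
  refine fun σ hσ => image_le_of_deriv_right_lt_deriv_boundary' hf hf'
    (B := fun _ => (0 : ℝ)) (B' := fun _ => 0) h0 continuousOn_const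
    (fun y _ => hasDerivWithinAt_const y (Ici y) 0) (fun y hy hy0 => ?_) hσ
  have hy0' : G.V (x y) = 0 := hy0
  have hb := G.barrier (x y) (hU y hy) hy0'
  have h1 := clm_apply_le_add (G.V' (x y)) (F (x y)) (W y)
  have h2 : ‖G.V' (x y)‖ * ‖W y - F (x y)‖ ≤ ‖G.V' (x y)‖ * ε :=
    mul_le_mul_of_nonneg_left (hW y hy).2 (norm_nonneg _)
  show G.V' (x y) (W y) < 0
  linarith

/-- **REACH.** Every such curve over the whole cycle `[0, τc]` from `Ain` visits `Aout`: otherwise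
`P ∘ x` has right derivative `≥ P'(x)·F(x) - ‖P'(x)‖ ε ≥ c` throughout (`progress`, the curve being
safe by `V_le_zero`), so `P (x τc) - P (x 0) ≥ c τc` (one-sided mean value inequality), against
`P (x τc) ≤ Pmax`, `P (x 0) ≥ Pmin`, `Pmax - Pmin < c τc`. [folklore] -/
theorem exists_mem_Aout (G : BarrierGate F U ε τc Ain Aout) {p : O} (hp : p ∈ Ain) {x : ℝ → O}
    (hx0 : x 0 = p)
    (hcont : ContinuousOn x (Icc 0 τc)) (hU : ∀ σ ∈ Ico 0 τc, x σ ∈ U)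
    (hW : ∀ σ ∈ Ico 0 τc, ∃ W : O, HasDerivWithinAt x W (Ici σ) σ ∧ ‖W - F (x σ)‖ ≤ ε) :
    ∃ σ ∈ Icc 0 τc, x σ ∈ Aout := by
  have h0 : G.V (x 0) ≤ 0 := by rw [hx0]; exact G.Ain_safe p hp
  have hsafe := G.V_le_zero h0 hcont hU hW
  by_contra hne
  push Not at hne
  choose! W hW using hW
  have hUall : ∀ σ ∈ Icc 0 τc, x σ ∈ U := fun σ hσ => G.safe_sub _ (hsafe σ hσ)
  have hg : ContinuousOn (fun σ => G.P (x σ)) (Icc 0 τc) := G.continuousOn_P.comp hcont hUall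
  have hg' : ∀ σ ∈ Ico 0 τc,
      HasDerivWithinAt (fun σ => G.P (x σ)) (G.P' (x σ) (W σ)) (Ici σ) σ :=
    fun σ hσ => (G.P_deriv (x σ) (hU σ hσ)).comp_hasDerivWithinAt σ (hW σ hσ).1
  have hbound : ∀ σ ∈ Ico 0 τc, G.c ≤ G.P' (x σ) (W σ) := by
    intro σ hσ
    have hpr := G.progress (x σ) (hU σ hσ) (hsafe σ (Ico_subset_Icc_self hσ))
      (hne σ (Ico_subset_Icc_self hσ))
    have h1 := clm_sub_le_apply (G.P' (x σ)) (F (x σ)) (W σ)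
    have h2 : ‖G.P' (x σ)‖ * ‖W σ - F (x σ)‖ ≤ ‖G.P' (x σ)‖ * ε :=
      mul_le_mul_of_nonneg_left (hW σ hσ).2 (norm_nonneg _)
    linarith
  have hmv := Literature.Analysis.ODE.mul_le_sub_of_le_deriv_right hg hg' hbound τc
    ⟨G.τc_nonneg, le_rfl⟩
  have hmax : G.P (x τc) ≤ G.Pmax := G.P_le _ (hsafe τc ⟨G.τc_nonneg, le_rfl⟩)
  have hmin : G.Pmin ≤ G.P (x 0) := by rw [hx0]; exact G.P_ge p hp
  have hb := G.budget
  simp only [sub_zero] at hmv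
  linarith

/-- **A barrier gate IS a reach certificate**, with the constant tube `Tube p σ := {V ≤ 0}`
(closed, contains `Ain`, inside `U`): AVOID by `V_le_zero`, REACH by `exists_mem_Aout`. [folklore] -/
def toReachCertificate : ReachCertificate F U ε τc Ain Aout where
  Tube := fun _ _ => G.Safe
  Tube_closed := fun _ _ => isClosed_Icc.prod G.isClosed_safe
  Tube_zero := fun p hp => G.Ain_subset_safe hp
  Tube_sub := fun _ _ _ _ => G.safe_subset
  cert := by
    intro p hp σT x hσT0 hσT hx0 hcont hU hW
    have h0 : G.V (x 0) ≤ 0 := by rw [hx0]; exact G.Ain_safe p hp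
    refine ⟨G.V_le_zero h0 hcont hU hW σT ⟨hσT0, le_rfl⟩, fun hστ => ?_⟩
    subst hστ
    exact G.exists_mem_Aout hp hx0 hcont hU hW

/-- The barrier gate's tube is the safe set, at every time. [folklore] -/
@[simp] theorem toReachCertificate_Tube (p : O) (σ : ℝ) :
    G.toReachCertificate.Tube p σ = G.Safe := rfl

/-- **A necessary condition every progress certificate pays** (trivial, recorded for the design
discussion): at a safe point off the output region, a positive robust rate `c > 0` forces the
tolerated defect below the design speed there, `ε < ‖F q‖` (`c + ‖P'‖ ε ≤ P'·F ≤ ‖P'‖ ‖F‖`). A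
delay produced by SLOWNESS of the design dynamics therefore caps the defect budget by that slow
speed; this is far from sufficient (for Tao's seed-driven gate the true cap, the seed rate
`ε² e^{-K¹⁰}`, is exponentially below its design speeds — `GateFragility.lean`). [folklore] -/
theorem ε_lt_norm_F (hc : 0 < G.c) {q : O} (hq : q ∈ U) (hV : G.V q ≤ 0) (hA : q ∉ Aout) :
    ε < ‖F q‖ := by
  have hpr := G.progress q hq hV hA
  have h1 : G.P' q (F q) ≤ ‖G.P' q‖ * ‖F q‖ :=
    (le_abs_self _).trans (by simpa only [Real.norm_eq_abs] using (G.P' q).le_opNorm (F q))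
  by_contra h
  have h2 : ‖G.P' q‖ * ‖F q‖ ≤ ‖G.P' q‖ * ε :=
    mul_le_mul_of_nonneg_left (not_lt.1 h) (norm_nonneg _)
  linarith

end BarrierGate

/-! ### §4. The margins: the barrier gate's defect budget is LINEAR -/

/-- **The robust barrier condition from margins**: inward normal speed `≥ mB` and gradient `≤ MB`
on the zero level, with `MB ε < mB` — the AVOID budget is `ε < mB / MB`, linear in the design's
data. [folklore] -/
theorem barrier_of_margins {F : O → O} {U : Set O} {V : O → ℝ} {V' : O → O →L[ℝ] ℝ}
    {mB MB ε : ℝ} (hε : 0 ≤ ε) (hm : MB * ε < mB)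
    (h : ∀ q ∈ U, V q = 0 → V' q (F q) ≤ -mB ∧ ‖V' q‖ ≤ MB) :
    ∀ q ∈ U, V q = 0 → V' q (F q) + ‖V' q‖ * ε < 0 := by
  intro q hq hV
  obtain ⟨h1, h2⟩ := h q hq hV
  have h3 : ‖V' q‖ * ε ≤ MB * ε := mul_le_mul_of_nonneg_right h2 hε
  linarith

/-- **The robust progress rate from margins**: design progress rate `≥ mP` and gradient `≤ MP` on
the safe set off `Aout` give the robust rate `c = mP - MP ε`; with the time budget
`Pmax - Pmin < (mP - MP ε) τc` the REACH budget is `ε < (mP τc - (Pmax - Pmin)) / (MP τc)`, again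
linear — against the Grönwall certificate's `ε ≤ δsh · L/(e^{Lτc} - 1)`. [folklore] -/
theorem progress_of_margins {F : O → O} {U : Set O} {V : O → ℝ} {P' : O → O →L[ℝ] ℝ}
    {Aout : Set O} {mP MP ε : ℝ} (hε : 0 ≤ ε)
    (h : ∀ q ∈ U, V q ≤ 0 → q ∉ Aout → mP ≤ P' q (F q) ∧ ‖P' q‖ ≤ MP) :
    ∀ q ∈ U, V q ≤ 0 → q ∉ Aout → (mP - MP * ε) + ‖P' q‖ * ε ≤ P' q (F q) := by
  intro q hq hV hA
  obtain ⟨h1, h2⟩ := h q hq hV hA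
  have h3 : ‖P' q‖ * ε ≤ MP * ε := mul_le_mul_of_nonneg_right h2 hε
  linarith

/-! ### §5. Calibration: the interface is inhabited with order-one margins -/

/-- **Calibration (non-vacuity with order-one defect).** The one-mode relaxation design
`q' = 2 - q` on the working region `U = (-1, 3)`, inputs `[0, 1/4]`, outputs `[3/2, ∞)`, cycle time
`11`, tolerates the defect `ε = 1/4`: barrier `V q = (q + 1/2)(q - 5/2)` (safe set `[-1/2, 5/2]`,
robust barrier condition `(2 - q)(2q - 2) + |2q - 2|/4 < 0` at `q = -1/2, 5/2`), progress `P q = q`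
with robust rate `c = 1/4` off the outputs, `Pmin = 0`, `Pmax = 5/2`, budget `5/2 < 11/4`. This is
a relaxation onto an equilibrium inside the output region, NOT a delayed abrupt transition: it
calibrates the interface (order-one data, order-one defect), it says nothing about Tao's gate.
[folklore] -/
def relaxationGate :
    BarrierGate (fun q : ℝ => 2 - q) (Ioo (-1) 3) (1 / 4) 11 (Icc 0 (1 / 4)) (Ici (3 / 2)) where
  U_open := isOpen_Ioo
  ε_nonneg := by norm_num
  τc_nonneg := by norm_num
  V := fun q => (q + 1 / 2) * (q - 5 / 2)
  V_cont := by fun_prop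
  V' := fun q => (1 : ℝ →L[ℝ] ℝ).smulRight (2 * q - 2)
  V_deriv := fun q _ =>
    ((((hasDerivAt_id' q).add_const (1 / 2 : ℝ)).mul
      ((hasDerivAt_id' q).sub_const (5 / 2 : ℝ))).congr_deriv (by ring)).hasFDerivAt
  safe_sub := by
    intro q hq
    have hq' : (q + 1 / 2) * (q - 5 / 2) ≤ 0 := hq
    constructor <;> nlinarith [hq']
  Ain_safe := by
    intro p hp
    show (p + 1 / 2) * (p - 5 / 2) ≤ 0
    nlinarith [hp.1, hp.2]
  barrier := by
    intro q _ hV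
    have hV' : (q + 1 / 2) * (q - 5 / 2) = 0 := hV
    have hn : ‖(1 : ℝ →L[ℝ] ℝ).smulRight (2 * q - 2)‖ = |2 * q - 2| := by
      rw [ContinuousLinearMap.norm_smulRight_apply, ContinuousLinearMap.one_def,
        ContinuousLinearMap.norm_id, one_mul, Real.norm_eq_abs]
    show ((1 : ℝ →L[ℝ] ℝ).smulRight (2 * q - 2)) (2 - q) +
      ‖(1 : ℝ →L[ℝ] ℝ).smulRight (2 * q - 2)‖ * (1 / 4) < 0
    rw [hn, ContinuousLinearMap.smulRight_apply, one_apply_eq_self, smul_eq_mul]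
    rcases mul_eq_zero.1 hV' with h | h
    · have hq : q = -1 / 2 := by linarith
      subst hq
      rw [abs_of_nonpos (by norm_num : (2 * (-1 / 2 : ℝ) - 2) ≤ 0)]
      norm_num
    · have hq : q = 5 / 2 := by linarith
      subst hq
      rw [abs_of_nonneg (by norm_num : (0 : ℝ) ≤ 2 * (5 / 2 : ℝ) - 2)]
      norm_num
  P := fun q => q
  P' := fun _ => (1 : ℝ →L[ℝ] ℝ).smulRight 1
  P_deriv := fun q _ => (hasDerivAt_id' q).hasFDerivAt
  c := 1 / 4
  progress := by
    intro q _ _ hA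
    have hA' : q < 3 / 2 := lt_of_not_ge fun h => hA (mem_Ici.2 h)
    have hn : ‖(1 : ℝ →L[ℝ] ℝ).smulRight (1 : ℝ)‖ = 1 := by
      rw [ContinuousLinearMap.norm_smulRight_apply, ContinuousLinearMap.one_def,
        ContinuousLinearMap.norm_id, norm_one, one_mul]
    show (1 / 4 : ℝ) + ‖(1 : ℝ →L[ℝ] ℝ).smulRight (1 : ℝ)‖ * (1 / 4) ≤
      ((1 : ℝ →L[ℝ] ℝ).smulRight (1 : ℝ)) (2 - q)
    rw [hn, ContinuousLinearMap.smulRight_apply, one_apply_eq_self, smul_eq_mul]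
    linarith
  Pmin := 0
  Pmax := 5 / 2
  P_ge := fun p hp => hp.1
  P_le := by
    intro q hV
    have hV' : (q + 1 / 2) * (q - 5 / 2) ≤ 0 := hV
    show q ≤ 5 / 2
    nlinarith [hV']
  budget := by norm_num

/-- The calibration gate's reach certificate: safe set `{(q + 1/2)(q - 5/2) ≤ 0}`, every
`1/4`-approximate trajectory from `[0, 1/4]` reaches `[3/2, ∞)` within rescaled time `11`.
[folklore] -/
example : ReachCertificate (fun q : ℝ => 2 - q) (Ioo (-1) 3) (1 / 4) 11 (Icc 0 (1 / 4))
    (Ici (3 / 2)) :=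
  relaxationGate.toReachCertificate

/-! ### §6. Re-certification of a reach design; barrier-certified designs -/

namespace ReachCircuit

open MeasureTheory
open scoped ENNReal
open Literature.Analysis.FluidPDE.Tao2016
open Literature.Analysis.FunctionSpaces (eFourierSobolevNorm)

variable {S : CascadeSpecs} {s : ℝ} (R : ReachCircuit S O s)

/-- **The CIRCUIT group of a reach design is a reach certificate** for its own
`(F, U, ε, τc, Ain, Aout)`. [cite: Tao2016AveragedNS, §1.3 pp. 10–11] -/
def certificate : ReachCertificate R.F R.U R.ε R.τc R.Ain R.Aout where
  Tube := R.Tube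
  Tube_closed := R.Tube_closed
  Tube_zero := R.Tube_zero
  Tube_sub := R.Tube_sub
  cert := R.cert

/-- **RE-CERTIFICATION**: replace the CIRCUIT group of a reach design by any reach certificate for
the same `(F, U, ε, τc, Ain, Aout)` (a barrier gate's, a validated-numerics tube, …); every other
field is kept. [cite: Tao2016AveragedNS, §1.3 pp. 10–11] -/
def withCertificate (C : ReachCertificate R.F R.U R.ε R.τc R.Ain R.Aout) : ReachCircuit S O s :=
  { R with
    Tube := C.Tube
    Tube_closed := C.Tube_closed
    Tube_zero := C.Tube_zero
    Tube_sub := C.Tube_sub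
    cert := C.cert }

/-- The re-certified design's tube is the certificate's. [folklore] -/
@[simp] theorem withCertificate_Tube (C : ReachCertificate R.F R.U R.ε R.τc R.Ain R.Aout) :
    (R.withCertificate C).Tube = C.Tube := rfl

/-- **Re-certification changes nothing downstream**: the pump cascade of the re-certified design —
hence its lifespan bounds, blow-up time, blow-up data and ignition ball — is literally the original
one (the certificate enters only the PROOF of `fires`). [folklore] -/
theorem withCertificate_toPumpCascade (C : ReachCertificate R.F R.U R.ε R.τc R.Ain R.Aout) :
    (R.withCertificate C).toPumpCascade = R.toPumpCascade := rfl

/-- … and the robust pump cascade likewise. [folklore] -/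
theorem withCertificate_toRobustPumpCascade (hs : 0 ≤ s)
    (C : ReachCertificate R.F R.U R.ε R.τc R.Ain R.Aout) :
    (R.withCertificate C).toRobustPumpCascade hs = R.toRobustPumpCascade hs := rfl

/-- **A reach design re-certified by a BARRIER GATE** for its own `(F, U, ε, τc, Ain, Aout)`: the
tube becomes the constant safe set `{V ≤ 0}`. [folklore] -/
def ofBarrier (G : BarrierGate R.F R.U R.ε R.τc R.Ain R.Aout) : ReachCircuit S O s :=
  R.withCertificate G.toReachCertificate

/-- The barrier-certified design's tube is the safe set. [folklore] -/
@[simp] theorem ofBarrier_Tube (G : BarrierGate R.F R.U R.ε R.τc R.Ain R.Aout) (p : O) (σ : ℝ) :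
    (R.ofBarrier G).Tube p σ = G.Safe := rfl

/-- **LIVENESS of a barrier-certifiable design** needs `H¹⁰` control only on the SAFE SLAB
`{v ∈ H¹⁰_df : read_n v ∈ {V ≤ 0}, junk_n v ≤ jrun √E_n}` — no tube, no flow: re-certify by the
barrier gate (`ofBarrier`), apply `live`, and transport along `withCertificate_toPumpCascade`.
[cite: Tao2016AveragedNS, §1.3 pp. 10–11] -/
theorem live_of_barrier (G : BarrierGate R.F R.U R.ε R.τc R.Ain R.Aout) (hth : H10MildTheory)
    (hctrl : ∀ n : ℕ, ∃ M : ℝ, ∀ v : L2C, MemH10df v → R.read n v ∈ G.Safe →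
      R.junk n v ≤ ENNReal.ofReal (R.jrun * Real.sqrt (S.Emin n)) →
        eFourierSobolevNorm 10 v ≤ ENNReal.ofReal M) :
    R.toPumpCascade.Live := by
  have hC : (R.ofBarrier G).H10Control := fun n => by
    obtain ⟨M, hM⟩ := hctrl n
    exact ⟨M, fun v hv ⟨_, _, _, _, hr⟩ hj => hM v hv hr hj⟩
  have h := (R.ofBarrier G).live hth hC
  rwa [ofBarrier, withCertificate_toPumpCascade] at h

end ReachCircuit

end Literature.Analysis.FluidPDE.FluidComputer

end
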